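import Summits.AtomisticToContinuum.Crystallization.Theorems.ChartedZeroExcessLayeredLatticeLiouvilleL

/-!
# ChartedZeroExcessLayered · LatticeLiouville — part M: §G «MinimisingDoor», the (β) pieces RESTRICTED to GSC door sets, seams, glue, columns
(decomp-a2c lens-2 generation 27; NEW content, imports part L)

Every piece of the g26 column (`_16B` / `_16K` / `_16BW` / `_16KW`: R, P♭, E, A∞, U, H♭, H_pert, K, N″) is re-typed with the door binder
`IsDoorSetP aHi δ S` replaced by the MINIMISING door `IsDoorSetPG aHi δ S := IsDoorSetP aHi δ S ∧ IsEStarGSC (μS S)` and NOTHING else changed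
(suffix `PG`; the texts are the part-I / part-H texts symbol for symbol otherwise).  Hence:
* every seam X_P ⟹ X_PG is `fun … S hS => h … S hS.1` (PROVED, one line each): the GSC pieces are WEAKER-or-equal leafwise;
* every glue theorem of parts I/J/H is re-proved VERBATIM (the proofs are pointwise in the door set `S`, whose binder is passed along opaque):
  E_G ⟺ A∞_G ∧ U_G, U_G ⟸ H♭_G (dyadic iteration from the floor `max R₀ R₁`), H♭_G ⟸ H_pert,G ∧ K_G (ratio `M_K·M_P`, contraction `1/(2C)`,
  basin `min κ₁ (κ₀/C)`), P♭_G ⟸ E_G (part G's exact endgame `exactEndgame_of_le`, GSC door sets being rooted and separated), N″_G ⟸ R_G ∧ P♭_G,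
  L1′♮_G ⟸ N″_G for `θ ≥ aHi/16` (the bootstrap `affineGood_of_isDoorSetP` on the door half of the binder);
* ★★ the columns land on N's registered conclusions through part L's `gap_and_pert_1_50_of_periodicG` (door, SparseNull, BindingSurface,
  WindowCounting discharged by name; `IsEStarGSC` supplied by the closed `MuEquilibriumDoor` inside `SparseMisfit`'s consumer):
  `_16BG`  : L → L_lay → R_G(2,1/16,1/16) → A∞_G(2,1/16,1/16) → H♭_G(2,1/16) → HBG″ → VisibleGap (1/50) ∧ PertRegime (1/50)   (SIX leaves);
  `_16KG`  : L → L_lay → R_G → A∞_G → K_G(2,1/16) → H_pert,G(2,1/16) → HBG″ → …                                          (SEVEN leaves);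
  `_16BWG` / `_16KWG` : the same at the W-ceiling `(103/100, 2, 103/1600, 1/16)` of record, reaching `DoorPeriodicPG 2 (103/100)`;
  and the OLD leaves still decide through the new columns (lens-2's `gap_and_pert_1_50_of_certs_16K_viaG`, omitted at landing as a
  gate duplicate of part J's `gap_and_pert_1_50_of_certs_16K`), so nothing of g26 is lost.
LEAVES AND TAGS after this cut (primary column `_16KG`; crit-1 to grade): L `LatticeLiouvilleCert`, L_lay `LayeredLiouvilleCert` [UNCHANGED];
R_G [WEAKER-or-equal than R · TRUE-type · census-SUPPORTED as R (TAG 162) · ATTACKABLE·L]; A∞_G [WEAKER-or-equal than A∞ · TRUE-type · NO LONGER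
IDEA-NEEDED on the special class: ⟸ X «ExcessFlatnessControl» (part N, PROVED reduction using the tree's BindingSurface + WindowCounting) — the
comparison ENERGY BOUND replaces the blow-down Liouville theorem]; K_G [WEAKER-or-equal than K · TRUE-type · ATTACKABLE·XL by EXCISION (a core of a
minimiser is cut out and replaced by the chart patch: GSC at equal particle number; needs Gårding of the energy on the clean tube = TAG 174 (a)
HOMOGENEOUS phonon stability only, not the inhomogeneous Hessian convexity (b)(c) the Nash line needs) · INSTRUMENTABLE: TAG 171 CORE-HUNT now decides
the STRICTNESS of K ⟹ K_G (every candidate core is a Nash-not-GSC witness)]; H_pert,G [WEAKER-or-equal · ATTACKABLE·L–XL: Caccioppoli / strong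
compactness for MINIMISERS is classical where for critical points it needs the John radius]; HBG″ [UNCHANGED].
DEF-light (nine `def … : Prop` = the restricted pieces), no sorry, axioms standard.
-/

noncomputable section

open scoped BigOperators InnerProductSpace RealInnerProductSpace
open MeasureTheory Set Metric Filter Topology
open Summit.AtomisticToContinuum.Crystallization.Theorems.ChartedPlanarOrderRigidityDoor (E3 IsClean IsNash IsCharted IsEStarGSC VisibleGap PertRegime atomsIn)
open Summit.AtomisticToContinuum.Crystallization.Theorems.ChartedPlanarOrderDensityDichotomy (μS IsSep nK nK_nonneg)
open Summit.AtomisticToContinuum.Crystallization.Theorems.ChartedPlanarOrderMesoCut (IsDoorSet NearHom LayeredHom EnvClose)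
open Summit.AtomisticToContinuum.Crystallization.Theorems.OverbindingBudgetLiouvilleDictionary (NearHomBD)
open Summit.AtomisticToContinuum.Crystallization.Theorems.ChartedPlanarOrderDoorLayered
  (TwoPeriodic DoorPeriodic PeriodicBulkGapDoor gap_and_pert_1_50_of_periodic NearHomL2BD nearHomL2BD_mono nearHomBD_of_nearHomL2BD
   sq_le_finsum_mem not_nearHomL2BD_singleton envClose_mono)
open Summit.AtomisticToContinuum.Crystallization.Theorems.ChartedPlanarOrderDoorLayeredOsc (IsTwoShellAffineGood DoorPeriodicOsc)
open Summit.AtomisticToContinuum.Crystallization.Theorems.ChartedPlanarOrderCleanScaleP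
  (IsCleanP IsDoorSetP DoorPeriodicP isDoorSetP_mono doorPeriodic_of_doorPeriodicP isDoorSetP_one_iff doorPeriodicP_one_iff)

namespace Summit.AtomisticToContinuum.Crystallization.Theorems.ChartedZeroExcessLayeredLatticeLiouville

/-! ## §G.3  The pieces on GSC door sets (texts = parts H/I with `IsDoorSetP aHi δ S ↦ IsDoorSetPG aHi δ S`) -/

/-- **R_G(aHi; Λ, θ, κ) «OscRigidityL2BDPG»** — the clean-scale rigidity inequality on GSC door sets: every root window of a θ-good e⋆-GSC
`aHi`-door set is κ-flat in mean square under a layered chart of distortion `≤ Λ`.  WEAKER-or-equal than R_P (`oscRigidityL2BDPG_of_P`).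
[this file, g27] -/
def OscRigidityL2BDPG (aHi Λ θ κ : ℝ) : Prop :=
  ∀ δ : ℝ, 0 < δ → ∀ S : Set E3, IsDoorSetPG aHi δ S → (∀ q ∈ S, IsTwoShellAffineGood θ S q) →
    ∀ R : ℝ, 0 < R → NearHomL2BD Λ κ 4 S (atomsIn (μS S) 0 R)

/-- **P♭_G(aHi; Λ, θ, κ) «LinearisedFlatnessLayeredPG»** — κ-flatness of all root windows of a θ-good GSC door set upgrades, given both linear
certificates, to EXACT two-periodicity.  WEAKER-or-equal than P♭_P. [this file, g27] -/
def LinearisedFlatnessLayeredPG (aHi Λ θ κ : ℝ) : Prop :=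
  LatticeLiouvilleCert → LayeredLiouvilleCert → ∀ δ : ℝ, 0 < δ → ∀ S : Set E3, IsDoorSetPG aHi δ S →
    (∀ q ∈ S, IsTwoShellAffineGood θ S q) → (∀ R : ℝ, 0 < R → NearHomL2BD Λ κ 4 S (atomsIn (μS S) 0 R)) → TwoPeriodic Λ S

/-- **E_G(aHi; Λ, θ, κ) «FlatnessExtinctionPG»** — flatness extinction on GSC door sets.  WEAKER-or-equal than E_P. [this file, g27] -/
def FlatnessExtinctionPG (aHi Λ θ κ : ℝ) : Prop :=
  LatticeLiouvilleCert → LayeredLiouvilleCert → ∀ δ : ℝ, 0 < δ → ∀ S : Set E3, IsDoorSetPG aHi δ S → (∀ q ∈ S, IsTwoShellAffineGood θ S q) →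
    (∀ R : ℝ, 0 < R → NearHomL2BD Λ κ 4 S (atomsIn (μS S) 0 R)) → AsymptoticallyLayerFlat Λ S

/-- **A∞_G(aHi; Λ, θ, κ) «ScaleExtinctionPG»** — BLOW-DOWN FLATNESS on GSC door sets: every θ-good κ-flat e⋆-GSC `aHi`-door set is EVENTUALLY
layer-flat.  WEAKER-or-equal than A∞_P (`scaleExtinctionPG_of_P`); on the special class it is no longer a Liouville statement but an ENERGY
statement: ⟸ X «ExcessFlatnessControlP» by the tree's comparison bound `BindingSurface` (part N, PROVED). [this file, g27] -/
def ScaleExtinctionPG (aHi Λ θ κ : ℝ) : Prop :=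
  LatticeLiouvilleCert → LayeredLiouvilleCert → ∀ δ : ℝ, 0 < δ → ∀ S : Set E3, IsDoorSetPG aHi δ S → (∀ q ∈ S, IsTwoShellAffineGood θ S q) →
    (∀ R : ℝ, 0 < R → NearHomL2BD Λ κ 4 S (atomsIn (μS S) 0 R)) → EventuallyLayerFlat Λ S

/-- **U_G(aHi; Λ, θ, κ) «FlatnessUpgradePG»** — NO CORES on GSC door sets: eventually layer-flat ⇒ asymptotically layer-flat.  WEAKER-or-equal than
U_P; ⟸ H♭_G (`flatnessUpgradePG_of_halvingBasin`). [this file, g27] -/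
def FlatnessUpgradePG (aHi Λ θ κ : ℝ) : Prop :=
  LatticeLiouvilleCert → LayeredLiouvilleCert → ∀ δ : ℝ, 0 < δ → ∀ S : Set E3, IsDoorSetPG aHi δ S → (∀ q ∈ S, IsTwoShellAffineGood θ S q) →
    (∀ R : ℝ, 0 < R → NearHomL2BD Λ κ 4 S (atomsIn (μS S) 0 R)) → EventuallyLayerFlat Λ S → AsymptoticallyLayerFlat Λ S

/-- **H♭_G(aHi; Λ, θ) «HalvingBasinPG»** — the one-step ε-regularity with existential basin, on GSC door sets.  WEAKER-or-equal than H♭_P;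
⟸ H_pert,G ∧ K_G (`halvingBasinPG_of_perturbative_core`). [this file, g27] -/
def HalvingBasinPG (aHi Λ θ : ℝ) : Prop :=
  LatticeLiouvilleCert → LayeredLiouvilleCert → ∀ δ : ℝ, 0 < δ → ∃ κ₀ : ℝ, 0 < κ₀ ∧ ∃ M : ℝ, 1 ≤ M ∧ ∃ R₀ : ℝ, 0 < R₀ ∧
    ∀ S : Set E3, IsDoorSetPG aHi δ S → (∀ q ∈ S, IsTwoShellAffineGood θ S q) →
      ∀ η : ℝ, 0 < η → η ≤ κ₀ → ∀ R : ℝ, R₀ ≤ R →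
        NearHomL2BD Λ η 4 S (atomsIn (μS S) 0 (M * R)) → NearHomL2BD Λ (η / 2) 4 S (atomsIn (μS S) 0 R)

/-- **H_pert,G(aHi; Λ, θ) «PerturbativeDecayPG»** — the perturbative (sup-flat) decay step on GSC door sets.  WEAKER-or-equal than H_pert,P; for
MINIMISERS the strong-compactness / Caccioppoli step of its proof of record is classical (reverse Hölder for minimisers), where for critical points it
needs the window to sit inside the convexity (John) radius. [this file, g27] -/
def PerturbativeDecayPG (aHi Λ θ : ℝ) : Prop :=
  LatticeLiouvilleCert → LayeredLiouvilleCert → ∀ δ : ℝ, 0 < δ → ∀ c : ℝ, 0 < c →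
    ∃ τ₀ : ℝ, 0 < τ₀ ∧ ∃ κ₀ : ℝ, 0 < κ₀ ∧ ∃ M : ℝ, 1 ≤ M ∧ ∃ R₀ : ℝ, 0 < R₀ ∧
      ∀ S : Set E3, IsDoorSetPG aHi δ S → (∀ q ∈ S, IsTwoShellAffineGood θ S q) →
        ∀ η : ℝ, 0 < η → η ≤ κ₀ → ∀ R : ℝ, R₀ ≤ R →
          NearHomL2SupBD Λ η τ₀ 4 S (atomsIn (μS S) 0 (M * R)) → NearHomL2BD Λ (c * η) 4 S (atomsIn (μS S) 0 R)

/-- **K_G(aHi; Λ, θ) «CoreExclusionPG»** — NO CORES IN MINIMISERS: the interior `L² → L^∞` flatness estimate on GSC door sets.  WEAKER-or-equal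
than K_P (`coreExclusionPG_of_P`); STRICTLY weaker exactly if a clean charted single-site-Nash cored configuration exists (census TAG 171 CORE-HUNT:
every candidate core is metastable = Nash with positive excess over the perfect ball at the same far field, hence NOT e⋆-GSC).  Attack of record on
the special class: EXCISION — replace the cored ball by the chart's layered patch (GSC at equal particle number; gluing cost = O(annulus misfit²),
which mean-square η-flatness of the big window makes small since `κ₁(τ₀)` is existential) against the core's energy `≥ c(τ₀) > 0` (Gårding of the
energy on the clean tube: HOMOGENEOUS phonon stability, TAG 174 (a), not the inhomogeneous Hessian convexity (b)(c)). [this file, g27] -/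
def CoreExclusionPG (aHi Λ θ : ℝ) : Prop :=
  LatticeLiouvilleCert → LayeredLiouvilleCert → ∀ δ : ℝ, 0 < δ → ∃ C : ℝ, 1 ≤ C ∧ ∃ M : ℝ, 1 ≤ M ∧ ∀ τ₀ : ℝ, 0 < τ₀ →
    ∃ κ₁ : ℝ, 0 < κ₁ ∧ ∃ R₀ : ℝ, 0 < R₀ ∧
      ∀ S : Set E3, IsDoorSetPG aHi δ S → (∀ q ∈ S, IsTwoShellAffineGood θ S q) →
        ∀ η : ℝ, 0 < η → η ≤ κ₁ → ∀ R : ℝ, R₀ ≤ R →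
          NearHomL2BD Λ η 4 S (atomsIn (μS S) 0 (M * R)) → NearHomL2SupBD Λ (C * η) τ₀ 4 S (atomsIn (μS S) 0 R)

/-- **N″_G(aHi; Λ, θ) «DoorPeriodicOscPG»** — the exact Liouville leaf on θ-good GSC door sets.  WEAKER-or-equal than N″_P. [this file, g27] -/
def DoorPeriodicOscPG (aHi Λ θ : ℝ) : Prop :=
  ∀ δ : ℝ, 0 < δ → ∀ S : Set E3, IsDoorSetPG aHi δ S → (∀ q ∈ S, IsTwoShellAffineGood θ S q) → TwoPeriodic Λ S

/-! ## §G.4  The seams X_P ⟹ X_PG (drop the GSC hypothesis; PROVED, one line each): the restricted pieces are WEAKER-or-equal -/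

/-- R_P ⟹ R_G. -/
theorem oscRigidityL2BDPG_of_P {aHi Λ θ κ : ℝ} (h : OscRigidityL2BDP aHi Λ θ κ) : OscRigidityL2BDPG aHi Λ θ κ :=
  fun δ hδ S hS => h δ hδ S hS.1

/-- P♭_P ⟹ P♭_G. -/
theorem linearisedFlatnessLayeredPG_of_P {aHi Λ θ κ : ℝ} (h : LinearisedFlatnessLayeredP aHi Λ θ κ) : LinearisedFlatnessLayeredPG aHi Λ θ κ :=
  fun hP hL δ hδ S hS => h hP hL δ hδ S hS.1

/-- E_P ⟹ E_G. -/
theorem flatnessExtinctionPG_of_P {aHi Λ θ κ : ℝ} (h : FlatnessExtinctionP aHi Λ θ κ) : FlatnessExtinctionPG aHi Λ θ κ :=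
  fun hP hL δ hδ S hS => h hP hL δ hδ S hS.1

/-- A∞_P ⟹ A∞_G. -/
theorem scaleExtinctionPG_of_P {aHi Λ θ κ : ℝ} (h : ScaleExtinctionP aHi Λ θ κ) : ScaleExtinctionPG aHi Λ θ κ :=
  fun hP hL δ hδ S hS => h hP hL δ hδ S hS.1

/-- U_P ⟹ U_G. -/
theorem flatnessUpgradePG_of_P {aHi Λ θ κ : ℝ} (h : FlatnessUpgradeP aHi Λ θ κ) : FlatnessUpgradePG aHi Λ θ κ :=
  fun hP hL δ hδ S hS => h hP hL δ hδ S hS.1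

/-- H♭_P ⟹ H♭_G. -/
theorem halvingBasinPG_of_P {aHi Λ θ : ℝ} (h : HalvingBasinP aHi Λ θ) : HalvingBasinPG aHi Λ θ := by
  intro hP hL δ hδ
  obtain ⟨κ₀, hκ₀, M, hM, R₀, hR₀, hstep⟩ := h hP hL δ hδ
  exact ⟨κ₀, hκ₀, M, hM, R₀, hR₀, fun S hS => hstep S hS.1⟩

/-- H_pert,P ⟹ H_pert,G. -/
theorem perturbativeDecayPG_of_P {aHi Λ θ : ℝ} (h : PerturbativeDecayP aHi Λ θ) : PerturbativeDecayPG aHi Λ θ := by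
  intro hP hL δ hδ c hc
  obtain ⟨τ₀, hτ₀, κ₀, hκ₀, M, hM, R₀, hR₀, hstep⟩ := h hP hL δ hδ c hc
  exact ⟨τ₀, hτ₀, κ₀, hκ₀, M, hM, R₀, hR₀, fun S hS => hstep S hS.1⟩

/-- K_P ⟹ K_G. -/
theorem coreExclusionPG_of_P {aHi Λ θ : ℝ} (h : CoreExclusionP aHi Λ θ) : CoreExclusionPG aHi Λ θ := by
  intro hP hL δ hδ
  obtain ⟨C, hC, M, hM, hK⟩ := h hP hL δ hδ
  refine ⟨C, hC, M, hM, fun τ₀ hτ₀ => ?_⟩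
  obtain ⟨κ₁, hκ₁, R₀, hR₀, hstep⟩ := hK τ₀ hτ₀
  exact ⟨κ₁, hκ₁, R₀, hR₀, fun S hS => hstep S hS.1⟩

/-- N″_P ⟹ N″_G. -/
theorem doorPeriodicOscPG_of_P {aHi Λ θ : ℝ} (h : DoorPeriodicOscP aHi Λ θ) : DoorPeriodicOscPG aHi Λ θ :=
  fun δ hδ S hS => h δ hδ S hS.1

/-- and from the `aHi = 1` leaves of record: R ⟹ R_G(1), A∞ ⟹ A∞_G(1), H♭ ⟹ H♭_G(1), K ⟹ K_G(1), H_pert ⟹ H_pert,G(1) (`Iff.rfl` then the seam). -/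
theorem oscRigidityL2BDPG_one_of {Λ θ κ : ℝ} (h : OscRigidityL2BD Λ θ κ) : OscRigidityL2BDPG 1 Λ θ κ :=
  oscRigidityL2BDPG_of_P ((oscRigidityL2BDP_one_iff Λ θ κ).2 h)

/-- `ScaleExtinction` gives the `PG` form at scale `1`. [folklore] -/
theorem scaleExtinctionPG_one_of {Λ θ κ : ℝ} (h : ScaleExtinction Λ θ κ) : ScaleExtinctionPG 1 Λ θ κ :=
  scaleExtinctionPG_of_P ((scaleExtinctionP_one_iff Λ θ κ).2 h)

/-- `HalvingBasin` gives the `PG` form at scale `1`. [folklore] -/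
theorem halvingBasinPG_one_of {Λ θ : ℝ} (h : HalvingBasin Λ θ) : HalvingBasinPG 1 Λ θ :=
  halvingBasinPG_of_P ((halvingBasinP_one_iff Λ θ).2 h)

/-- `CoreExclusion` gives the `PG` form at scale `1`. [folklore] -/
theorem coreExclusionPG_one_of {Λ θ : ℝ} (h : CoreExclusion Λ θ) : CoreExclusionPG 1 Λ θ :=
  coreExclusionPG_of_P ((coreExclusionP_one_iff Λ θ).2 h)

/-- `PerturbativeDecay` gives the `PG` form at scale `1`. [folklore] -/
theorem perturbativeDecayPG_one_of {Λ θ : ℝ} (h : PerturbativeDecay Λ θ) : PerturbativeDecayPG 1 Λ θ :=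
  perturbativeDecayPG_of_P ((perturbativeDecayP_one_iff Λ θ).2 h)

/-! ## §G.5  The glue, re-proved verbatim on the special class -/

/-- **E_G ⟸ A∞_G ∧ U_G.** -/
theorem flatnessExtinctionPG_of_scale_upgrade {aHi Λ θ κ : ℝ} (hA : ScaleExtinctionPG aHi Λ θ κ) (hU : FlatnessUpgradePG aHi Λ θ κ) :
    FlatnessExtinctionPG aHi Λ θ κ :=
  fun hP hL δ hδ S hS hO hflat => hU hP hL δ hδ S hS hO hflat (hA hP hL δ hδ S hS hO hflat)

/-- **A∞_G ⟸ E_G.** -/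
theorem scaleExtinctionPG_of_extinction {aHi Λ θ κ : ℝ} (hE : FlatnessExtinctionPG aHi Λ θ κ) : ScaleExtinctionPG aHi Λ θ κ :=
  fun hP hL δ hδ S hS hO hflat => (hE hP hL δ hδ S hS hO hflat).eventually

/-- **U_G ⟸ E_G.** -/
theorem flatnessUpgradePG_of_extinction {aHi Λ θ κ : ℝ} (hE : FlatnessExtinctionPG aHi Λ θ κ) : FlatnessUpgradePG aHi Λ θ κ :=
  fun hP hL δ hδ S hS hO hflat _ => hE hP hL δ hδ S hS hO hflat

/-- ★ **E_G ⟺ A∞_G ∧ U_G.** -/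
theorem flatnessExtinctionPG_iff_scale_upgrade (aHi Λ θ κ : ℝ) :
    FlatnessExtinctionPG aHi Λ θ κ ↔ ScaleExtinctionPG aHi Λ θ κ ∧ FlatnessUpgradePG aHi Λ θ κ :=
  ⟨fun h => ⟨scaleExtinctionPG_of_extinction h, flatnessUpgradePG_of_extinction h⟩, fun h => flatnessExtinctionPG_of_scale_upgrade h.1 h.2⟩

/-- ★ **U_G ⟸ H♭_G at EVERY κ** (dyadic iteration from the floor `max R₀ R₁`, verbatim from part I). -/
theorem flatnessUpgradePG_of_halvingBasin {aHi Λ θ : ℝ} (κ : ℝ) (hH : HalvingBasinPG aHi Λ θ) : FlatnessUpgradePG aHi Λ θ κ := by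
  intro hP hL δ hδ S hS hO _hflat hev
  obtain ⟨κ₀, hκ₀, M, hM, R₀, hR₀, hstep⟩ := hH hP hL δ hδ
  obtain ⟨R₁, hR₁⟩ := hev κ₀ hκ₀
  have iter : ∀ k : ℕ, ∀ R : ℝ, max R₀ R₁ ≤ R → NearHomL2BD Λ (κ₀ / 2 ^ k) 4 S (atomsIn (μS S) 0 R) := by
    intro k
    induction k with
    | zero => intro R hR; simpa using hR₁ R ((le_max_right _ _).trans hR)
    | succ k ih =>
      intro R hR
      have hRnn : 0 ≤ R := hR₀.le.trans ((le_max_left _ _).trans hR)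
      have hMR : max R₀ R₁ ≤ M * R := hR.trans (le_mul_of_one_le_left hRnn hM)
      have h1 := hstep S hS hO (κ₀ / 2 ^ k) (by positivity) (div_le_self hκ₀.le (one_le_pow₀ (by norm_num))) R
        ((le_max_left _ _).trans hR) (ih (M * R) hMR)
      rwa [pow_succ, ← div_div]
  refine ⟨max R₀ R₁, fun ε hε R hR => ?_⟩
  obtain ⟨k, hk⟩ := exists_pow_lt_of_lt_one (div_pos hε hκ₀) (by norm_num : (1 / 2 : ℝ) < 1)
  refine nearHomL2BD_mono ?_ (iter k R hR)
  rw [div_eq_mul_inv, ← inv_pow, show ((2:ℝ)⁻¹) = 1 / 2 by norm_num]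
  have := (lt_div_iff₀ hκ₀).1 hk
  linarith [this]

/-- ★ **H♭_G ⟸ H_pert,G ∧ K_G** (verbatim from part J: ratio `M_K·M_P`, contraction `c = 1/(2C)`, basin `min κ₁ (κ₀/C)`). -/
theorem halvingBasinPG_of_perturbative_core {aHi Λ θ : ℝ} (hPd : PerturbativeDecayPG aHi Λ θ) (hK : CoreExclusionPG aHi Λ θ) :
    HalvingBasinPG aHi Λ θ := by
  intro hP hL δ hδ
  obtain ⟨C, hC, M', hM', hK'⟩ := hK hP hL δ hδ
  have hCpos : 0 < C := lt_of_lt_of_le one_pos hC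
  obtain ⟨τ₀, hτ₀, κ₀, hκ₀, M, hM, R₀, hR₀, hstepP⟩ := hPd hP hL δ hδ (1 / (2 * C)) (by positivity)
  obtain ⟨κ₁, hκ₁, R₀', hR₀', hstepK⟩ := hK' τ₀ hτ₀
  refine ⟨min κ₁ (κ₀ / C), lt_min hκ₁ (div_pos hκ₀ hCpos), M' * M, one_le_mul_of_one_le_of_one_le hM' hM,
    max R₀ R₀', hR₀.trans_le (le_max_left _ _), fun S hS hO η hη hηκ R hR hW => ?_⟩
  have hRnn : 0 ≤ R := hR₀.le.trans ((le_max_left _ _).trans hR)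
  have hMR : R₀' ≤ M * R := ((le_max_right _ _).trans hR).trans (le_mul_of_one_le_left hRnn hM)
  have hW' : NearHomL2BD Λ η 4 S (atomsIn (μS S) 0 (M' * (M * R))) := by rw [← mul_assoc]; exact hW
  have hsup := hstepK S hS hO η hη (hηκ.trans (min_le_left _ _)) (M * R) hMR hW'
  have hCη : C * η ≤ κ₀ := by
    have h1 : η ≤ κ₀ / C := hηκ.trans (min_le_right _ _)
    rw [le_div_iff₀ hCpos] at h1
    linarith [h1]
  have h2 := hstepP S hS hO (C * η) (by positivity) hCη R ((le_max_left _ _).trans hR) hsup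
  have h3 : 1 / (2 * C) * (C * η) = η / 2 := by field_simp
  rw [h3] at h2
  exact h2

/-- ★ **E_G ⟸ A∞_G ∧ H♭_G** at every κ. -/
theorem flatnessExtinctionPG_of_scale_basin {aHi Λ θ κ : ℝ} (hA : ScaleExtinctionPG aHi Λ θ κ) (hH : HalvingBasinPG aHi Λ θ) :
    FlatnessExtinctionPG aHi Λ θ κ :=
  flatnessExtinctionPG_of_scale_upgrade hA (flatnessUpgradePG_of_halvingBasin κ hH)

/-- **P♭_G ⟸ E_G** at every `Λ ≤ 4` (part G's exact endgame; GSC door sets are rooted `hS.1.1` and separated `hS.1.2.1`). -/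
theorem linearisedFlatnessLayeredPG_of_extinction {aHi Λ θ κ : ℝ} (hΛ : Λ ≤ 4) (hE : FlatnessExtinctionPG aHi Λ θ κ) :
    LinearisedFlatnessLayeredPG aHi Λ θ κ :=
  fun hP hL δ hδ S hS hO hflat => exactEndgame_of_le hΛ δ hδ S hS.1.1 hS.1.2.1 (hE hP hL δ hδ S hS hO hflat)

/-- ★★ **P♭_G ⟸ A∞_G ∧ H♭_G** (`Λ ≤ 4`). -/
theorem linearisedFlatnessLayeredPG_of_scale_basin {aHi Λ θ κ : ℝ} (hΛ : Λ ≤ 4) (hA : ScaleExtinctionPG aHi Λ θ κ)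
    (hH : HalvingBasinPG aHi Λ θ) : LinearisedFlatnessLayeredPG aHi Λ θ κ :=
  linearisedFlatnessLayeredPG_of_extinction hΛ (flatnessExtinctionPG_of_scale_basin hA hH)

/-- ★ **N″_G ⟸ R_G ∧ P♭_G ∧ both certificates** (R_G supplies the κ-flat windows P♭_G consumes; no decay piece: both at one level κ). -/
theorem doorPeriodicOscPG_of_two {aHi Λ θ κ : ℝ} (hL : LatticeLiouvilleCert) (hL' : LayeredLiouvilleCert)
    (hR : OscRigidityL2BDPG aHi Λ θ κ) (hP : LinearisedFlatnessLayeredPG aHi Λ θ κ) : DoorPeriodicOscPG aHi Λ θ :=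
  fun δ hδ S hS hO => hP hL hL' δ hδ S hS hO (fun R hRpos => hR δ hδ S hS hO R hRpos)

/-- ★ **L1′♮_G ⟸ N″_G for `θ ≥ aHi/16`** (the bootstrap is free on the door half of the binder: `affineGood_of_isDoorSetP`). -/
theorem doorPeriodicPG_of_oscPG {aHi Λ θ : ℝ} (hθ : aHi / 16 ≤ θ) (h : DoorPeriodicOscPG aHi Λ θ) : DoorPeriodicPG Λ aHi :=
  fun δ hδ S hS => h δ hδ S hS (affineGood_of_isDoorSetP hθ hS.1)

/-! ## §G.6  The g27 columns on N's registered conclusions (special class only; door inputs discharged by name in part L) -/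

/-- ★★ **COLUMN `_16BG` — SIX leaves**: `LatticeLiouvilleCert → LayeredLiouvilleCert → R_G(2,1/16,1/16) → A∞_G(2,1/16,1/16) → H♭_G(2,1/16) → HBG″ →
VisibleGap (1/50) ∧ PertRegime (1/50)`. -/
theorem gap_and_pert_1_50_of_certs_16BG (hL : LatticeLiouvilleCert) (hL' : LayeredLiouvilleCert) (hR : OscRigidityL2BDPG 1 2 (1 / 16) (1 / 16))
    (hA : ScaleExtinctionPG 1 2 (1 / 16) (1 / 16)) (hB : HalvingBasinPG 1 2 (1 / 16)) (hG : PeriodicBulkGapDoor 2) :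
    VisibleGap (1 / 50) ∧ PertRegime (1 / 50) :=
  gap_and_pert_1_50_of_periodicG
    (doorPeriodicPG_of_oscPG (by norm_num) (doorPeriodicOscPG_of_two hL hL' hR (linearisedFlatnessLayeredPG_of_scale_basin (by norm_num) hA hB))) hG

/-- ★★ **COLUMN `_16KG` — SEVEN leaves, THE PRIMARY COLUMN OF THIS NODE**: `LatticeLiouvilleCert → LayeredLiouvilleCert → R_G(2,1/16,1/16) →
A∞_G(2,1/16,1/16) → K_G(2,1/16) → H_pert,G(2,1/16) → HBG″ → VisibleGap (1/50) ∧ PertRegime (1/50)`. -/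
theorem gap_and_pert_1_50_of_certs_16KG (hL : LatticeLiouvilleCert) (hL' : LayeredLiouvilleCert) (hR : OscRigidityL2BDPG 1 2 (1 / 16) (1 / 16))
    (hA : ScaleExtinctionPG 1 2 (1 / 16) (1 / 16)) (hK : CoreExclusionPG 1 2 (1 / 16)) (hPd : PerturbativeDecayPG 1 2 (1 / 16))
    (hG : PeriodicBulkGapDoor 2) : VisibleGap (1 / 50) ∧ PertRegime (1 / 50) :=
  gap_and_pert_1_50_of_certs_16BG hL hL' hR hA (halvingBasinPG_of_perturbative_core hPd hK) hG

/-- ★ **COLUMN `_16EG` — FIVE leaves through E_G = A∞_G ∧ U_G.** -/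
theorem gap_and_pert_1_50_of_certs_16EG (hL : LatticeLiouvilleCert) (hL' : LayeredLiouvilleCert) (hR : OscRigidityL2BDPG 1 2 (1 / 16) (1 / 16))
    (hE : FlatnessExtinctionPG 1 2 (1 / 16) (1 / 16)) (hG : PeriodicBulkGapDoor 2) : VisibleGap (1 / 50) ∧ PertRegime (1 / 50) :=
  gap_and_pert_1_50_of_periodicG
    (doorPeriodicPG_of_oscPG (by norm_num) (doorPeriodicOscPG_of_two hL hL' hR (linearisedFlatnessLayeredPG_of_extinction (by norm_num) hE))) hG

/-- ★★ **THE `_16BWG` COLUMN, door half** (W-ceiling of record `103/100`, oscillation `103/1600`): `LatticeLiouvilleCert → LayeredLiouvilleCert →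
R_G,W → A∞_G,W → H♭_G,W → DoorPeriodicPG 2 (103/100)`. -/
theorem doorPeriodicPGW_of_certs_16BWG (hL : LatticeLiouvilleCert) (hL' : LayeredLiouvilleCert)
    (hR : OscRigidityL2BDPG (103 / 100) 2 (103 / 1600) (1 / 16)) (hA : ScaleExtinctionPG (103 / 100) 2 (103 / 1600) (1 / 16))
    (hB : HalvingBasinPG (103 / 100) 2 (103 / 1600)) : DoorPeriodicPG 2 (103 / 100) :=
  doorPeriodicPG_of_oscPG (by norm_num)
    (doorPeriodicOscPG_of_two hL hL' hR (linearisedFlatnessLayeredPG_of_scale_basin (by norm_num) hA hB))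

/-- ★★ **THE `_16BWG` COLUMN to N's conclusions — SIX leaves** (ceiling `1 ≤ 103/100` by `DoorPeriodicPG.anti`). -/
theorem gap_and_pert_1_50_of_certs_16BWG (hL : LatticeLiouvilleCert) (hL' : LayeredLiouvilleCert)
    (hR : OscRigidityL2BDPG (103 / 100) 2 (103 / 1600) (1 / 16)) (hA : ScaleExtinctionPG (103 / 100) 2 (103 / 1600) (1 / 16))
    (hB : HalvingBasinPG (103 / 100) 2 (103 / 1600)) (hG : PeriodicBulkGapDoor 2) : VisibleGap (1 / 50) ∧ PertRegime (1 / 50) :=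
  gap_and_pert_1_50_of_periodicG ((doorPeriodicPGW_of_certs_16BWG hL hL' hR hA hB).anti (by norm_num)) hG

/-- ★ **THE `_16KWG` COLUMN, door half — K_G,W and H_pert,G,W in place of H♭_G,W.** -/
theorem doorPeriodicPGW_of_certs_16KWG (hL : LatticeLiouvilleCert) (hL' : LayeredLiouvilleCert)
    (hR : OscRigidityL2BDPG (103 / 100) 2 (103 / 1600) (1 / 16)) (hA : ScaleExtinctionPG (103 / 100) 2 (103 / 1600) (1 / 16))
    (hK : CoreExclusionPG (103 / 100) 2 (103 / 1600)) (hPd : PerturbativeDecayPG (103 / 100) 2 (103 / 1600)) : DoorPeriodicPG 2 (103 / 100) :=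
  doorPeriodicPGW_of_certs_16BWG hL hL' hR hA (halvingBasinPG_of_perturbative_core hPd hK)

/-- ★★ **THE `_16KWG` COLUMN to N's conclusions — SEVEN leaves.** -/
theorem gap_and_pert_1_50_of_certs_16KWG (hL : LatticeLiouvilleCert) (hL' : LayeredLiouvilleCert)
    (hR : OscRigidityL2BDPG (103 / 100) 2 (103 / 1600) (1 / 16)) (hA : ScaleExtinctionPG (103 / 100) 2 (103 / 1600) (1 / 16))
    (hK : CoreExclusionPG (103 / 100) 2 (103 / 1600)) (hPd : PerturbativeDecayPG (103 / 100) 2 (103 / 1600)) (hG : PeriodicBulkGapDoor 2) :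
    VisibleGap (1 / 50) ∧ PertRegime (1 / 50) :=
  gap_and_pert_1_50_of_periodicG ((doorPeriodicPGW_of_certs_16KWG hL hL' hR hA hK hPd).anti (by norm_num)) hG

-- (landing note, hand-2 g11: lens-2's sanity theorem `gap_and_pert_1_50_of_certs_16K_viaG` — the g26 leaves deciding THROUGH the
-- GSC column — is omitted here: its statement is identical to `gap_and_pert_1_50_of_certs_16K` (part J) and the gate dedups it.)

end Summit.AtomisticToContinuum.Crystallization.Theorems.ChartedZeroExcessLayeredLatticeLiouville

end
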